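import Summits.CriticalPhenomena.PercolationContinuityZ3.Theorems.PercNearOneGluingNoHeavyLowerTailSahiTwoLevelVariationalMoves
import Mathlib.Tactic.Linarith
import Mathlib.Tactic.Ring
import HarnessLib

/-!
# FILL BOUNDS for the two-level TOP law: the expansion of `T⁺` around the sure top / sure bottom of one slot,
# and the three closed-form unconditional lower bounds `Φ₀, Ψ₀, Ξ₀ ≤ T⁺(G,H)`

Support file of the one-cut programme (crux `NoHeavyLowerTail`, stmt-CriticalPhenomena-4575; master-family line P2 = Sahi's
algebraic route, seat `prim-masterthm-p2` gen 21; memo `run/shared/lean/prim/prim-masterthm/FROM-prim-masterthm-p2-g21-TOP-ABSORBING.md`).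
No definition, no sorry; axioms standard.  Companion of `…SahiTwoLevelTopAbsorbing` (the case `G₁ ∩ G₂ ⊆ G₀` of `Φ₀`).

SETTING (`…SahiTwoLevelVariational{,Moves}`).  `μ = prodBernoulli q` on a finite cube, `T⁺(G,H) = topForm q G H` the TOP two-level
form of two triples of events (`SahiTwoLevelPlus`: `T⁺ ≥ 0` at nested pairs of increasing triples; implies Kahn's Conjecture 5).
By the compact form the point coefficient of the top `G₀` is the CONSTANT
`α⁺ = 2 − μ(H₁H₂) − μH₁(1 − μG₂) − μH₂(1 − μG₁) − μG₁μG₂` ON `G₁ ∩ G₂` and is `≤ 0` OFF it; the point coefficient of the bottom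
`H₀` is the constant `γ⁺ = 2 − μG₁ − μG₂ − Cov(G₁,G₂)` ON `H₁ ∩ H₂` and `≤ 0` OFF it (P2 gen 20, `topForm_top_increment`,
`topForm_bottom_increment`).  Consequences recorded here (slot `0` designated; any slot by `topForm_rot`):

* `topForm_topFill₀_eq` — **filling the top up to the complement of `G₁ ∩ G₂`** changes `T⁺` by an explicit amount:
  `T⁺((G₀ ∪ (G₁G₂)ᶜ, G₁, G₂), H) = T⁺((Ω, G₁, G₂), H) − α⁺·μ(G₁G₂ ∖ G₀)`, and `topForm_top₀_univ_eq` is the closed form of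
  `T⁺((Ω, G₁, G₂), H)`.  **`topForm_topFill₀_le`**: for nested increasing slots `1,2` this filled value is `≤ T⁺(G,H)` (move (T+)).
  So `Φ₀(G,H) := T⁺((Ω,G₁,G₂),H) − α⁺·μ(G₁G₂ ∖ G₀) ≤ T⁺(G,H)` — an UNCONDITIONAL closed-form lower bound in the moments of the six
  events (`topFill₀_le_topForm`).  When `G₁G₂ ⊆ G₀` it is `T⁺((Ω,G₁,G₂),H) ≥ 0` (bnk-2's independent tops): the top-absorbing face.
* `topForm_bottomFill₀_eq` / `topForm_bottomFill₀_le` / `bottomFill₀_le_topForm` — the same for the bottom: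
  `Ψ₀(G,H) := T⁺(G,(Ω,H₁,H₂)) − γ⁺·μ(H₁H₂ ∖ H₀) ≤ T⁺(G,H)`, with `T⁺(G,(Ω,H₁,H₂))` in closed form (`topForm_bottom₀_univ_eq`).
* `fill₀_le_topForm` — both: `Ξ₀ := μ(H₁H₂) + μ(G₁G₂) − μG₁μH₂ − μG₂μH₁ − γ⁺·μ(H₁H₂ ∖ H₀) − α⁺·μ(G₁G₂ ∖ G₀) ≤ T⁺(G,H)`.

WHY THEY MATTER (census of this seat, exact/float cross-checked, `code/census2.py`, memo §3): on `{0,1}^3` (ALL 4 741 632 ordered nested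
sextuples, biases `q ≡ ½` and `(.3,.5,.7)`) and on `{0,1}^4` (3 × 3·10⁵ uniform random nested sextuples, biases `½`, `(.3,.5,.7,.4)`,
`(.55,.25,.65,.1)`), EVERY nested pair of increasing triples satisfies at least one of: (a) it lies in a face where `T⁺ ≥ 0` is already
proved (bnk-2's W-face / costless-inside / independent pair of tops / `κ₃(G) ≥ 0` / idle slot with nonnegative bracket, or the
top-absorbing face of `…SahiTwoLevelTopAbsorbing`), or (b) `max_i Φ_i(G,H) ≥ 0` or `max_i Ψ_i(G,H) ≥ 0` (numerically; `Φ` suffices in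
all but ≤ 84 of the sampled cases per bias) — i.e. these closed-form fill bounds CERTIFY the top law configuration by configuration on
everything the older faces leave open at `m ≤ 4` (the uncovered sets there: `{0,1}^3` 3 558 / 3 564 sextuples = the co-sunflower tops
`(x₀∨x₁, x₀∨x₂, x₁∨x₂)`; `{0,1}^4` ≈ 2.8 %).  What remains for a PROOF of `SahiTwoLevelPlus` along this line is to show
`max_i Φ_i ≥ 0` (or a face) structurally; `Φ_i < 0` for all `i` does occur (1 134 sextuples of `{0,1}^3` at `q ≡ ½`, all inside the
older faces, e.g. `G = H = (x₀,x₁,x₂)` with `T⁺ = 0`).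

HONEST LABEL: identities and one-sided inequalities (Harris); nothing here asserts `SahiTwoLevelPlus` or Kahn's Conjecture 5 (OPEN). [this work]
-/

noncomputable section

open scoped Classical

namespace Summit.CriticalPhenomena.PercolationContinuityZ3.Theorems

namespace SahiTwoLevelVariational

open Finset Function MeasureTheory
open Literature.Combinatorics.Sahi2008
open Literature.Probability.LatticeModels (prodBernoulli prodBernoulli_harris)

variable {κ : Type} [Fintype κ]

/-! ### 1. The sure top in slot `0` and the top fill -/

omit [Fintype κ] in
/-- **Closed form of `T⁺` with the sure event as slot-`0` top**:
`T⁺((Ω,G₁,G₂),H) = 2μ(H₀H₁H₂) − μ(H₁H₂) − μG₁·μ(H₀H₂) − μG₂·μ(H₀H₁) − μH₀·Cov(G₁,G₂) + 2μ(G₁G₂) − μG₁μG₂`. [this work] -/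
theorem topForm_top₀_univ_eq (q : κ → unitInterval) (G₁ G₂ : Set (Set κ)) (H : Fin 3 → Set (Set κ)) :
    topForm q ![(Set.univ : Set (Set κ)), G₁, G₂] H =
      2 * (prodBernoulli q).real (H 0 ∩ H 1 ∩ H 2) - (prodBernoulli q).real (H 1 ∩ H 2)
      - (prodBernoulli q).real G₁ * (prodBernoulli q).real (H 0 ∩ H 2) - (prodBernoulli q).real G₂ * (prodBernoulli q).real (H 0 ∩ H 1)
      - (prodBernoulli q).real (H 0) * ((prodBernoulli q).real (G₁ ∩ G₂) - (prodBernoulli q).real G₁ * (prodBernoulli q).real G₂)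
      + 2 * (prodBernoulli q).real (G₁ ∩ G₂) - (prodBernoulli q).real G₁ * (prodBernoulli q).real G₂ := by
  rw [topForm_eq_compact]
  simp only [Matrix.cons_val_zero, Matrix.cons_val_one, Matrix.cons_val_two, Matrix.head_cons, Matrix.tail_cons,
    Set.univ_inter, probReal_univ]
  ring

/-- **TOP FILL IDENTITY**: filling the slot-`0` top up to the complement of `G₁ ∩ G₂` gives
`T⁺((G₀ ∪ (G₁G₂)ᶜ, G₁, G₂), H) = T⁺((Ω, G₁, G₂), H) − α⁺·μ(G₁G₂ ∖ G₀)` with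
`α⁺ = 2 − μ(H₁H₂) − μH₁(1 − μG₂) − μH₂(1 − μG₁) − μG₁μG₂` (the constant top coefficient on `G₁ ∩ G₂`). [this work] -/
theorem topForm_topFill₀_eq (q : κ → unitInterval) (G H : Fin 3 → Set (Set κ)) :
    topForm q ![G 0 ∪ (G 1 ∩ G 2)ᶜ, G 1, G 2] H =
      topForm q ![(Set.univ : Set (Set κ)), G 1, G 2] H
      - (2 - (prodBernoulli q).real (H 1 ∩ H 2) - (prodBernoulli q).real (H 1) * (1 - (prodBernoulli q).real (G 2))
          - (prodBernoulli q).real (H 2) * (1 - (prodBernoulli q).real (G 1)) - (prodBernoulli q).real (G 1) * (prodBernoulli q).real (G 2))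
        * (prodBernoulli q).real ((G 1 ∩ G 2) \ G 0) := by
  -- add `A = (G₁ ∩ G₂) ∖ G₀` to the filled top `G₀ ∪ (G₁G₂)ᶜ`: the union is the sure event
  set A : Set (Set κ) := (G 1 ∩ G 2) \ G 0 with hAdef
  have hdisj : Disjoint (G 0 ∪ (G 1 ∩ G 2)ᶜ) A := by
    rw [Set.disjoint_iff]
    rintro ω ⟨h1, h2⟩
    rcases h1 with h0 | hc
    · exact h2.2 h0
    · exact hc h2.1
  have hU : G 0 ∪ (G 1 ∩ G 2)ᶜ ∪ A = Set.univ := by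
    ext ω
    simp only [Set.mem_union, Set.mem_compl_iff, hAdef, Set.mem_sdiff, Set.mem_univ, iff_true]
    by_cases h0 : ω ∈ G 0
    · exact Or.inl (Or.inl h0)
    · by_cases h12 : ω ∈ G 1 ∩ G 2
      · exact Or.inr ⟨h12, h0⟩
      · exact Or.inl (Or.inr h12)
  have h := topForm_top_increment q H (G 0 ∪ (G 1 ∩ G 2)ᶜ) A (G 1) (G 2) hdisj
  rw [hU] at h
  have hA12 : A ∩ G 1 ∩ G 2 = A := by
    ext ω; simp only [Set.mem_inter_iff, hAdef, Set.mem_sdiff]; tauto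
  have hA2 : A ∩ G 2 = A := by
    ext ω; simp only [Set.mem_inter_iff, hAdef, Set.mem_sdiff]; tauto
  have hA1 : A ∩ G 1 = A := by
    ext ω; simp only [Set.mem_inter_iff, hAdef, Set.mem_sdiff]; tauto
  rw [hA12, hA2, hA1] at h
  linear_combination (-1 : ℝ) * h

/-- **MOVE (T+) TO THE TOP FILL**: for increasing `H₁ ⊆ G₁`, `H₂ ⊆ G₂`, filling the slot-`0` top up to the complement of `G₁ ∩ G₂` does
not increase `T⁺`: `T⁺((G₀ ∪ (G₁G₂)ᶜ, G₁, G₂), H) ≤ T⁺(G,H)` (the filled top need not be increasing; `T⁺` is a polynomial in the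
moments). [this work] -/
theorem topForm_topFill₀_le (q : κ → unitInterval) (G H : Fin 3 → Set (Set κ))
    (hH1 : IsUpperSet (H 1)) (hH2 : IsUpperSet (H 2)) (hH1G : H 1 ⊆ G 1) (hH2G : H 2 ⊆ G 2) :
    topForm q ![G 0 ∪ (G 1 ∩ G 2)ᶜ, G 1, G 2] H ≤ topForm q G H := by
  have hA : ((G 1 ∩ G 2)ᶜ \ G 0) ∩ G 1 ∩ G 2 = ∅ :=
    Set.subset_empty_iff.1 fun ω hω => (hω.1.1.1 ⟨hω.1.2, hω.2⟩).elim
  have h := topForm_top_union_le q H (G 0) ((G 1 ∩ G 2)ᶜ \ G 0) (G 1) (G 2) hH1 hH2 hH1G hH2G Set.disjoint_sdiff_right hA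
  have hG : (![G 0, G 1, G 2] : Fin 3 → Set (Set κ)) = G := by funext i; fin_cases i <;> rfl
  rwa [Set.union_sdiff_self, hG] at h

/-- **THE TOP-FILL BOUND `Φ₀ ≤ T⁺`** (closed form, unconditional for nested increasing slots `1,2`):
`T⁺(G,H) ≥ T⁺((Ω,G₁,G₂),H) − α⁺·μ(G₁G₂ ∖ G₀)`. [this work] -/
theorem topFill₀_le_topForm (q : κ → unitInterval) (G H : Fin 3 → Set (Set κ))
    (hH1 : IsUpperSet (H 1)) (hH2 : IsUpperSet (H 2)) (hH1G : H 1 ⊆ G 1) (hH2G : H 2 ⊆ G 2) :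
    2 * (prodBernoulli q).real (H 0 ∩ H 1 ∩ H 2) - (prodBernoulli q).real (H 1 ∩ H 2)
      - (prodBernoulli q).real (G 1) * (prodBernoulli q).real (H 0 ∩ H 2) - (prodBernoulli q).real (G 2) * (prodBernoulli q).real (H 0 ∩ H 1)
      - (prodBernoulli q).real (H 0) * ((prodBernoulli q).real (G 1 ∩ G 2) - (prodBernoulli q).real (G 1) * (prodBernoulli q).real (G 2))
      + 2 * (prodBernoulli q).real (G 1 ∩ G 2) - (prodBernoulli q).real (G 1) * (prodBernoulli q).real (G 2)
      - (2 - (prodBernoulli q).real (H 1 ∩ H 2) - (prodBernoulli q).real (H 1) * (1 - (prodBernoulli q).real (G 2))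
          - (prodBernoulli q).real (H 2) * (1 - (prodBernoulli q).real (G 1)) - (prodBernoulli q).real (G 1) * (prodBernoulli q).real (G 2))
        * (prodBernoulli q).real ((G 1 ∩ G 2) \ G 0)
      ≤ topForm q G H := by
  have h1 := topForm_topFill₀_le q G H hH1 hH2 hH1G hH2G
  have h2 := topForm_topFill₀_eq q G H
  have h3 := topForm_top₀_univ_eq q (G 1) (G 2) H
  linarith

/-! ### 2. The sure bottom in slot `0` and the bottom fill -/

omit [Fintype κ] in
/-- **Closed form of `T⁺` with the sure event as slot-`0` bottom**:
`T⁺(G,(Ω,H₁,H₂)) = 2μ(H₁H₂) − μG₁μH₂ − μG₂μH₁ − Cov(G₁,G₂) + 2μ(G₀G₁G₂) − μG₀·μ(H₁H₂) − μH₁·Cov(G₀,G₂) − μH₂·Cov(G₀,G₁) − μG₀μG₁μG₂`.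
[this work] -/
theorem topForm_bottom₀_univ_eq (q : κ → unitInterval) (G : Fin 3 → Set (Set κ)) (H₁ H₂ : Set (Set κ)) :
    topForm q G ![(Set.univ : Set (Set κ)), H₁, H₂] =
      2 * (prodBernoulli q).real (H₁ ∩ H₂) - (prodBernoulli q).real (G 1) * (prodBernoulli q).real H₂
      - (prodBernoulli q).real (G 2) * (prodBernoulli q).real H₁
      - ((prodBernoulli q).real (G 1 ∩ G 2) - (prodBernoulli q).real (G 1) * (prodBernoulli q).real (G 2))
      + 2 * (prodBernoulli q).real (G 0 ∩ G 1 ∩ G 2) - (prodBernoulli q).real (G 0) * (prodBernoulli q).real (H₁ ∩ H₂)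
      - (prodBernoulli q).real H₁ * ((prodBernoulli q).real (G 0 ∩ G 2) - (prodBernoulli q).real (G 0) * (prodBernoulli q).real (G 2))
      - (prodBernoulli q).real H₂ * ((prodBernoulli q).real (G 0 ∩ G 1) - (prodBernoulli q).real (G 0) * (prodBernoulli q).real (G 1))
      - (prodBernoulli q).real (G 0) * (prodBernoulli q).real (G 1) * (prodBernoulli q).real (G 2) := by
  rw [topForm_eq_compact]
  simp only [Matrix.cons_val_zero, Matrix.cons_val_one, Matrix.cons_val_two, Matrix.head_cons, Matrix.tail_cons,
    Set.univ_inter, probReal_univ]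
  ring

/-- **BOTTOM FILL IDENTITY**: `T⁺(G,(H₀ ∪ (H₁H₂)ᶜ, H₁, H₂)) = T⁺(G,(Ω,H₁,H₂)) − γ⁺·μ(H₁H₂ ∖ H₀)` with
`γ⁺ = 2 − μG₁ − μG₂ − Cov(G₁,G₂)` (the constant bottom coefficient on `H₁ ∩ H₂`). [this work] -/
theorem topForm_bottomFill₀_eq (q : κ → unitInterval) (G H : Fin 3 → Set (Set κ)) :
    topForm q G ![H 0 ∪ (H 1 ∩ H 2)ᶜ, H 1, H 2] =
      topForm q G ![(Set.univ : Set (Set κ)), H 1, H 2]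
      - (2 - (prodBernoulli q).real (G 1) - (prodBernoulli q).real (G 2)
          - ((prodBernoulli q).real (G 1 ∩ G 2) - (prodBernoulli q).real (G 1) * (prodBernoulli q).real (G 2)))
        * (prodBernoulli q).real ((H 1 ∩ H 2) \ H 0) := by
  set A : Set (Set κ) := (H 1 ∩ H 2) \ H 0 with hAdef
  have hdisj : Disjoint (H 0 ∪ (H 1 ∩ H 2)ᶜ) A := by
    rw [Set.disjoint_iff]
    rintro ω ⟨h1, h2⟩
    rcases h1 with h0 | hc
    · exact h2.2 h0
    · exact hc h2.1
  have hU : H 0 ∪ (H 1 ∩ H 2)ᶜ ∪ A = Set.univ := by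
    ext ω
    simp only [Set.mem_union, Set.mem_compl_iff, hAdef, Set.mem_sdiff, Set.mem_univ, iff_true]
    by_cases h0 : ω ∈ H 0
    · exact Or.inl (Or.inl h0)
    · by_cases h12 : ω ∈ H 1 ∩ H 2
      · exact Or.inr ⟨h12, h0⟩
      · exact Or.inl (Or.inr h12)
  have h := topForm_bottom_increment q G (H 0 ∪ (H 1 ∩ H 2)ᶜ) A (H 1) (H 2) hdisj
  rw [hU] at h
  have hA12 : A ∩ H 1 ∩ H 2 = A := by
    ext ω; simp only [Set.mem_inter_iff, hAdef, Set.mem_sdiff]; tauto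
  have hA2 : A ∩ H 2 = A := by
    ext ω; simp only [Set.mem_inter_iff, hAdef, Set.mem_sdiff]; tauto
  have hA1 : A ∩ H 1 = A := by
    ext ω; simp only [Set.mem_inter_iff, hAdef, Set.mem_sdiff]; tauto
  rw [hA12, hA2, hA1] at h
  linear_combination (-1 : ℝ) * h

/-- **MOVE (B+) TO THE BOTTOM FILL**: for increasing `G₁, G₂`, `T⁺(G,(H₀ ∪ (H₁H₂)ᶜ, H₁, H₂)) ≤ T⁺(G,H)`. [this work] -/
theorem topForm_bottomFill₀_le (q : κ → unitInterval) (G H : Fin 3 → Set (Set κ))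
    (hG1 : IsUpperSet (G 1)) (hG2 : IsUpperSet (G 2)) :
    topForm q G ![H 0 ∪ (H 1 ∩ H 2)ᶜ, H 1, H 2] ≤ topForm q G H := by
  have hA : ((H 1 ∩ H 2)ᶜ \ H 0) ∩ H 1 ∩ H 2 = ∅ :=
    Set.subset_empty_iff.1 fun ω hω => (hω.1.1.1 ⟨hω.1.2, hω.2⟩).elim
  have h := topForm_bottom_union_le q G (H 0) ((H 1 ∩ H 2)ᶜ \ H 0) (H 1) (H 2) hG1 hG2 Set.disjoint_sdiff_right hA
  have hH : (![H 0, H 1, H 2] : Fin 3 → Set (Set κ)) = H := by funext i; fin_cases i <;> rfl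
  rwa [Set.union_sdiff_self, hH] at h

/-- **THE BOTTOM-FILL BOUND `Ψ₀ ≤ T⁺`** (closed form, unconditional for increasing `G₁, G₂`):
`T⁺(G,H) ≥ T⁺(G,(Ω,H₁,H₂)) − γ⁺·μ(H₁H₂ ∖ H₀)`. [this work] -/
theorem bottomFill₀_le_topForm (q : κ → unitInterval) (G H : Fin 3 → Set (Set κ))
    (hG1 : IsUpperSet (G 1)) (hG2 : IsUpperSet (G 2)) :
    2 * (prodBernoulli q).real (H 1 ∩ H 2) - (prodBernoulli q).real (G 1) * (prodBernoulli q).real (H 2)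
      - (prodBernoulli q).real (G 2) * (prodBernoulli q).real (H 1)
      - ((prodBernoulli q).real (G 1 ∩ G 2) - (prodBernoulli q).real (G 1) * (prodBernoulli q).real (G 2))
      + 2 * (prodBernoulli q).real (G 0 ∩ G 1 ∩ G 2) - (prodBernoulli q).real (G 0) * (prodBernoulli q).real (H 1 ∩ H 2)
      - (prodBernoulli q).real (H 1) * ((prodBernoulli q).real (G 0 ∩ G 2) - (prodBernoulli q).real (G 0) * (prodBernoulli q).real (G 2))
      - (prodBernoulli q).real (H 2) * ((prodBernoulli q).real (G 0 ∩ G 1) - (prodBernoulli q).real (G 0) * (prodBernoulli q).real (G 1))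
      - (prodBernoulli q).real (G 0) * (prodBernoulli q).real (G 1) * (prodBernoulli q).real (G 2)
      - (2 - (prodBernoulli q).real (G 1) - (prodBernoulli q).real (G 2)
          - ((prodBernoulli q).real (G 1 ∩ G 2) - (prodBernoulli q).real (G 1) * (prodBernoulli q).real (G 2)))
        * (prodBernoulli q).real ((H 1 ∩ H 2) \ H 0)
      ≤ topForm q G H := by
  have h1 := topForm_bottomFill₀_le q G H hG1 hG2
  have h2 := topForm_bottomFill₀_eq q G H
  have h3 := topForm_bottom₀_univ_eq q G (H 1) (H 2)
  linarith

/-! ### 3. Both fills -/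

/-- **THE DOUBLE-FILL BOUND `Ξ₀ ≤ T⁺`**: for a nested pair of increasing events in slots `1,2`,
`T⁺(G,H) ≥ μ(H₁H₂) + μ(G₁G₂) − μG₁μH₂ − μG₂μH₁ − γ⁺·μ(H₁H₂ ∖ H₀) − α⁺·μ(G₁G₂ ∖ G₀)`
(on the doubly absorbing face `H₁H₂ ⊆ H₀`, `G₁G₂ ⊆ G₀` this is `…SahiTwoLevelTopAbsorbing.le_topForm_of_absorbing₀`). [this work] -/
theorem fill₀_le_topForm (q : κ → unitInterval) (G H : Fin 3 → Set (Set κ))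
    (hG1 : IsUpperSet (G 1)) (hG2 : IsUpperSet (G 2)) (hH1 : IsUpperSet (H 1)) (hH2 : IsUpperSet (H 2))
    (hH1G : H 1 ⊆ G 1) (hH2G : H 2 ⊆ G 2) :
    (prodBernoulli q).real (H 1 ∩ H 2) + (prodBernoulli q).real (G 1 ∩ G 2)
      - (prodBernoulli q).real (G 1) * (prodBernoulli q).real (H 2) - (prodBernoulli q).real (G 2) * (prodBernoulli q).real (H 1)
      - (2 - (prodBernoulli q).real (G 1) - (prodBernoulli q).real (G 2)
          - ((prodBernoulli q).real (G 1 ∩ G 2) - (prodBernoulli q).real (G 1) * (prodBernoulli q).real (G 2)))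
        * (prodBernoulli q).real ((H 1 ∩ H 2) \ H 0)
      - (2 - (prodBernoulli q).real (H 1 ∩ H 2) - (prodBernoulli q).real (H 1) * (1 - (prodBernoulli q).real (G 2))
          - (prodBernoulli q).real (H 2) * (1 - (prodBernoulli q).real (G 1)) - (prodBernoulli q).real (G 1) * (prodBernoulli q).real (G 2))
        * (prodBernoulli q).real ((G 1 ∩ G 2) \ G 0)
      ≤ topForm q G H := by
  -- bottom fill at the top-filled configuration, then top fill
  have h1 := topForm_topFill₀_le q G H hH1 hH2 hH1G hH2G
  have h2 := topForm_topFill₀_eq q G H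
  have h3 := topForm_bottomFill₀_le q ![(Set.univ : Set (Set κ)), G 1, G 2] H hG1 hG2
  have h4 := topForm_bottomFill₀_eq q ![(Set.univ : Set (Set κ)), G 1, G 2] H
  have h5 := topForm_bottom₀_univ_eq q ![(Set.univ : Set (Set κ)), G 1, G 2] (H 1) (H 2)
  simp only [Matrix.cons_val_zero, Matrix.cons_val_one, Matrix.cons_val_two, Matrix.head_cons, Matrix.tail_cons,
    Set.univ_inter, probReal_univ] at h4 h5
  linarith

end SahiTwoLevelVariational

end Summit.CriticalPhenomena.PercolationContinuityZ3.Theorems
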